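import Mathlib
import HarnessLib
import Literature.Analysis.FluidPDE.AxisymPoloidalCutoff
import Literature.Analysis.FluidPDE.SobolevWholeSpace
import Literature.Analysis.FluidPDE.NSVorticityBKMProofs
import Literature.Analysis.FluidPDE.LeraySeparationOfEnergyTools

/-!
# Shelf 1574, line `sparse_sieve`: the FAR-FIELD `L³` BOUND (energy + exterior enstrophy ⇒ exterior `L³`)

Helper file (`--supports stmt-NavierStokesRegularity-1574 --as helper`), the analytic input of the
COARSE-SCALE half of the no-loss certificate for stub S2 `UniformSparseness` of
`Cruxes/EnstrophyQuarterLaw/Lines/sparse_sieve.lean` (companions: `…Sparseness.sparse_fine_of_window`,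
`…SparsenessEarly.sparse_early_of_lerayHopf`; the residual named in the g0 repair census was "late times at
coarse scales — far field by an exterior `L³` bound from `FarFieldEnstrophy` + energy + exterior Sobolev").

* `norm_curl_smul_le`, `abs_divergence_smul_le` — Leibniz bounds `‖curl (ψv)‖ ≤ |ψ| ‖curl v‖ + 4‖Dψ‖‖v‖`,
  `|div (ψv)| ≤ ‖Dψ‖ ‖v‖` (`div v = 0`);
* `lintegral_shell_norm_cube_le` / `lintegral_exterior_norm_cube_le` — **exterior `L³` from energy and
  exterior enstrophy**: for every `C²` divergence-free field `v` on `ℝ³` with `∫ |v|² ≤ E₂` and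
  `∫_{|x| ≥ ρ} |curl v|² ≤ B` (`ρ > 0`), `∫_{|x| ≥ 2ρ} |v|³ ≤ K^{3/2} E₂^{3/4} (2B + 33 (2C/ρ)² E₂)^{3/4}`
  (`K` Mathlib's GNS constant, `C` the gradient constant of the tree's cut-off). The packaged form with one
  absolute constant and the application to Leray–Hopf classical solutions are in `…SparsenessCoarse`.

PROOF. Cut off: `w = ψ v`, `ψ = (1 − χ_ρ) χ_R` with the tree's dyadic cut-off `χ` (`WholeSpaceIBP`:
`χ_ρ = 1` on `|x| ≤ ρ`, `= 0` on `|x| ≥ 2ρ`, `‖Dχ_ρ‖ ≤ C/ρ`), so `w ∈ C²_c`, `w = v` on the shell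
`2ρ ≤ |x| ≤ R`, `|ψ| ≤ 1`, `‖Dψ‖ ≤ 2C/ρ` (`R ≥ ρ`). The `div`–`curl` identity for compactly supported
fields (`integral_frobeniusNormSq_fderiv_eq_of_hasCompactSupport`) and the Leibniz rules
`curl (ψv) = ψ curl v + curl[Dψ ⊗ v]`, `div (ψv) = ⟪v, ∇ψ⟫` (`div v = 0`) give
`∫ ‖Dw‖² ≤ ∫ |Dw|²_F = ∫ ‖curl w‖² + ∫ (div w)² ≤ 2B + 33 (2C/ρ)² E₂`; the whole-space `L³`
Gagliardo–Nirenberg inequality (`integral_norm_pow_three_le_of_integrable`: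
`∫‖w‖³ ≤ K^{3/2} (∫‖w‖²)^{3/4} (∫‖Dw‖²)^{3/4}`) bounds `∫_{2ρ ≤ |x| ≤ R} |v|³ ≤ ∫ |w|³` uniformly in
`R`, and `R → ∞` is monotone convergence (`setLIntegral_iUnion_of_directed`).

HONEST FRAMING: a Sobolev-type lemma about ONE vector field; nothing here bears on the regularity problem;
`EnstrophyQuarterLaw` (1574) and `UniformSparseness` (S2) stay OPEN. No summit statement is proved.
-/

noncomputable section

-- the summit-side namespace repeats a component by design (D-0017)
set_option linter.dupNamespace false

namespace Summit.NavierStokesRegularity.NavierStokesRegularity.Theorems.EnstrophyQuarterLaw.SparsenessFarField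

open Set MeasureTheory Function Metric Filter Topology
open scoped ENNReal NNReal RealInnerProductSpace
open Literature.Analysis.FluidPDE

/-! ### From `lintegral` bounds to Bochner integrals -/

/-- A non-negative a.e.-strongly measurable real function whose `lintegral` is at most `ofReal B`
(`B ≥ 0`) is integrable with integral at most `B`. [folklore] -/
theorem integrable_and_integral_le_of_lintegral_le {X : Type*} [MeasurableSpace X] {μ : Measure X}
    {f : X → ℝ} (hf : AEStronglyMeasurable f μ) (hf0 : ∀ x, 0 ≤ f x) {B : ℝ} (hB : 0 ≤ B)
    (h : ∫⁻ x, ENNReal.ofReal (f x) ∂μ ≤ ENNReal.ofReal B) :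
    Integrable f μ ∧ ∫ x, f x ∂μ ≤ B := by
  have hfin : HasFiniteIntegral f μ := by
    refine lt_of_le_of_lt ?_ (h.trans_lt ENNReal.ofReal_lt_top)
    refine (lintegral_congr fun x => ?_).le
    rw [Real.enorm_eq_ofReal (hf0 x)]
  have hint : Integrable f μ := ⟨hf, hfin⟩
  refine ⟨hint, ?_⟩
  rw [integral_eq_lintegral_of_nonneg_ae (Eventually.of_forall hf0) hf]
  calc (∫⁻ x, ENNReal.ofReal (f x) ∂μ).toReal ≤ (ENNReal.ofReal B).toReal :=
        ENNReal.toReal_mono ENNReal.ofReal_ne_top h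
    _ = B := ENNReal.toReal_ofReal hB

/-- The squared norm of a continuous field with `∫⁻ ‖v‖ₑ² ≤ ofReal E₂` is integrable with
`∫ ‖v‖² ≤ E₂`. [folklore] -/
theorem integrable_norm_sq_of_lintegral_le {v : EuclideanSpace ℝ (Fin 3) → EuclideanSpace ℝ (Fin 3)}
    (hv : Continuous v) {E₂ : ℝ} (hE₂ : 0 ≤ E₂)
    (h2 : ∫⁻ x, ‖v x‖ₑ ^ 2 ≤ ENNReal.ofReal E₂) :
    Integrable (fun x => ‖v x‖ ^ 2) ∧ ∫ x, ‖v x‖ ^ 2 ≤ E₂ := by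
  refine integrable_and_integral_le_of_lintegral_le (f := fun x => ‖v x‖ ^ 2)
    (hv.norm.pow 2).aestronglyMeasurable (fun x => by positivity) hE₂ ?_
  refine le_of_eq_of_le (lintegral_congr fun x => ?_) h2
  rw [← ofReal_norm, ENNReal.ofReal_pow (norm_nonneg _)]

/-! ### Leibniz bounds for a scalar cut-off times a divergence-free field -/

/-- **`curl (ψ v) = ψ curl v + curl[Dψ ⊗ v]`, in norm**: `‖curl (ψ v)(x)‖ ≤ |ψ x| ‖curl v x‖ + 4 ‖Dψ x‖ ‖v x‖`
(`curl = curlCLM ∘ D`, `‖curlCLM‖ ≤ 4`). [folklore] -/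
theorem norm_curl_smul_le {ψ : EuclideanSpace ℝ (Fin 3) → ℝ}
    {v : EuclideanSpace ℝ (Fin 3) → EuclideanSpace ℝ (Fin 3)} {x : EuclideanSpace ℝ (Fin 3)}
    (hψ : DifferentiableAt ℝ ψ x) (hv : DifferentiableAt ℝ v x) :
    ‖curl (fun y => ψ y • v y) x‖ ≤ |ψ x| * ‖curl v x‖ + 4 * ‖fderiv ℝ ψ x‖ * ‖v x‖ := by
  rw [curl_eq_curlCLM, curl_eq_curlCLM, fderiv_fun_smul hψ hv, map_add, map_smul]
  refine (norm_add_le _ _).trans (add_le_add ?_ ?_)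
  · rw [norm_smul, Real.norm_eq_abs]
  · calc ‖curlCLM ((fderiv ℝ ψ x).smulRight (v x))‖
        ≤ ‖curlCLM‖ * ‖(fderiv ℝ ψ x).smulRight (v x)‖ := ContinuousLinearMap.le_opNorm _ _
      _ ≤ 4 * (‖fderiv ℝ ψ x‖ * ‖v x‖) := by
          rw [ContinuousLinearMap.norm_smulRight_apply]
          exact mul_le_mul_of_nonneg_right norm_curlCLM_le_four (by positivity)
      _ = 4 * ‖fderiv ℝ ψ x‖ * ‖v x‖ := by ring

/-- **`div (ψ v) = ⟪v, ∇ψ⟫` for divergence-free `v`, in norm**: `|div (ψ v)(x)| ≤ ‖Dψ x‖ ‖v x‖`.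
[folklore] -/
theorem abs_divergence_smul_le {ψ : EuclideanSpace ℝ (Fin 3) → ℝ}
    {v : EuclideanSpace ℝ (Fin 3) → EuclideanSpace ℝ (Fin 3)} {x : EuclideanSpace ℝ (Fin 3)}
    (hψ : DifferentiableAt ℝ ψ x) (hv : DifferentiableAt ℝ v x)
    (hdiv : VectorCalculus.divergence v x = 0) :
    |VectorCalculus.divergence (fun y => ψ y • v y) x| ≤ ‖fderiv ℝ ψ x‖ * ‖v x‖ := by
  rw [divergence_smul_apply hψ hv, hdiv, mul_zero, zero_add]
  have hg : ‖gradient ψ x‖ = ‖fderiv ℝ ψ x‖ := by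
    rw [gradient]
    exact LinearIsometryEquiv.norm_map _ _
  calc |⟪v x, gradient ψ x⟫| ≤ ‖v x‖ * ‖gradient ψ x‖ := abs_real_inner_le_norm _ _
    _ = ‖fderiv ℝ ψ x‖ * ‖v x‖ := by rw [hg, mul_comm]

/-! ### The exterior `L³` bound -/

/-- **Exterior `L³` from energy and exterior enstrophy (shell form, uniform in the outer radius).**
With `C` the gradient constant of the tree's cut-off (`exists_norm_fderiv_cutoff_le`) and `K` Mathlib's GNS
constant: for a `C²` divergence-free `v` with `∫⁻ ‖v‖ₑ² ≤ E₂`, `∫⁻_{|x| ≥ ρ} ‖curl v‖ₑ² ≤ B` (`ρ > 0`) and every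
`R ≥ ρ`, `∫⁻_{2ρ ≤ |x| ≤ R} ‖v‖ₑ³ ≤ K^{3/2} E₂^{3/4} (2B + 33 (2C/ρ)² E₂)^{3/4}`. [folklore] -/
theorem lintegral_shell_norm_cube_le {C : ℝ} (hC0 : 0 ≤ C)
    (hC : ∀ R : ℝ, 0 < R → ∀ x : EuclideanSpace ℝ (Fin 3), ‖fderiv ℝ (cutoff R) x‖ ≤ C / R)
    {v : EuclideanSpace ℝ (Fin 3) → EuclideanSpace ℝ (Fin 3)} (hv : ContDiff ℝ 2 v)
    (hdiv : VectorCalculus.IsDivFree v) {E₂ B ρ R : ℝ} (hE₂ : 0 ≤ E₂) (hB : 0 ≤ B) (hρ : 0 < ρ)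
    (hρR : ρ ≤ R) (h2 : ∫⁻ x, ‖v x‖ₑ ^ 2 ≤ ENNReal.ofReal E₂)
    (hcurl : ∫⁻ x in (ball (0 : EuclideanSpace ℝ (Fin 3)) ρ)ᶜ, ‖curl v x‖ₑ ^ 2 ≤ ENNReal.ofReal B) :
    ∫⁻ x in {x : EuclideanSpace ℝ (Fin 3) | 2 * ρ ≤ ‖x‖ ∧ ‖x‖ ≤ R}, ‖v x‖ₑ ^ 3 ≤
      ENNReal.ofReal ((SNormLESNormFDerivOfEqConst (EuclideanSpace ℝ (Fin 3))
          (volume : Measure (EuclideanSpace ℝ (Fin 3))) 2 : ℝ) ^ (3 / 2 : ℝ) * E₂ ^ (3 / 4 : ℝ) *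
        (2 * B + 33 * (2 * C / ρ) ^ 2 * E₂) ^ (3 / 4 : ℝ)) := by
  have hR : 0 < R := hρ.trans_le hρR
  set K : ℝ := (SNormLESNormFDerivOfEqConst (EuclideanSpace ℝ (Fin 3))
    (volume : Measure (EuclideanSpace ℝ (Fin 3))) 2 : ℝ) with hK
  -- ### the annular cut-off `ψ = (1 − χ_ρ) χ_R`
  set ψ : EuclideanSpace ℝ (Fin 3) → ℝ := fun y => (1 - cutoff ρ y) * cutoff R y with hψ
  have hψs : ContDiff ℝ 2 ψ :=
    (contDiff_const.sub (contDiff_cutoff (n := 2) ρ)).mul (contDiff_cutoff (n := 2) R)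
  have hψd : ∀ y, DifferentiableAt ℝ ψ y := fun y => (hψs.differentiable (by simp)) y
  have hψ01 : ∀ y, 0 ≤ ψ y ∧ ψ y ≤ 1 := fun y => by
    have h0 := cutoff_nonneg ρ y; have h1 := cutoff_le_one ρ y
    have h0' := cutoff_nonneg R y; have h1' := cutoff_le_one R y
    exact ⟨mul_nonneg (by linarith) h0', by nlinarith⟩
  have hψabs : ∀ y, |ψ y| ≤ 1 := fun y => abs_le.2 ⟨by linarith [(hψ01 y).1], (hψ01 y).2⟩
  have hψin : ∀ y : EuclideanSpace ℝ (Fin 3), ‖y‖ ≤ ρ → ψ y = 0 := fun y hy => by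
    simp only [hψ, cutoff_eq_one hρ hy, sub_self, zero_mul]
  have hψone : ∀ y : EuclideanSpace ℝ (Fin 3), 2 * ρ ≤ ‖y‖ → ‖y‖ ≤ R → ψ y = 1 := fun y hy1 hy2 => by
    simp only [hψ, cutoff_eq_zero hρ hy1, cutoff_eq_one hR hy2, sub_zero, one_mul]
  have hψc : HasCompactSupport ψ := (hasCompactSupport_cutoff (E := EuclideanSpace ℝ (Fin 3)) hR).mul_left
  -- `‖Dψ‖ ≤ 2C/ρ`
  set Cψ : ℝ := 2 * C / ρ with hCψ
  have hCψ0 : 0 ≤ Cψ := by positivity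
  have hDψ : ∀ y, ‖fderiv ℝ ψ y‖ ≤ Cψ := by
    intro y
    have hd1 : DifferentiableAt ℝ (fun z => 1 - cutoff ρ z) y :=
      ((contDiff_const.sub (contDiff_cutoff (n := 1) ρ)).differentiable (by simp)) y
    have hd2 : DifferentiableAt ℝ (cutoff R) y := ((contDiff_cutoff (n := 1) R).differentiable (by simp)) y
    have hdρ : DifferentiableAt ℝ (cutoff ρ) y := ((contDiff_cutoff (n := 1) ρ).differentiable (by simp)) y
    have e : fderiv ℝ ψ y = (1 - cutoff ρ y) • fderiv ℝ (cutoff R) y +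
        cutoff R y • fderiv ℝ (fun z => 1 - cutoff ρ z) y := by
      rw [hψ]; exact fderiv_fun_mul hd1 hd2
    have e2 : fderiv ℝ (fun z => 1 - cutoff ρ z) y = -fderiv ℝ (cutoff ρ) y := by
      rw [fderiv_fun_sub (differentiableAt_const _) hdρ, fderiv_fun_const, Pi.zero_apply, zero_sub]
    rw [e, e2]
    have h1ρ : |1 - cutoff ρ y| ≤ 1 := by
      have := cutoff_nonneg ρ y; have := cutoff_le_one ρ y
      exact abs_le.2 ⟨by linarith, by linarith⟩
    have h1R : |cutoff R y| ≤ 1 := abs_cutoff_le_one R y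
    calc ‖(1 - cutoff ρ y) • fderiv ℝ (cutoff R) y + cutoff R y • -fderiv ℝ (cutoff ρ) y‖
        ≤ ‖(1 - cutoff ρ y) • fderiv ℝ (cutoff R) y‖ + ‖cutoff R y • -fderiv ℝ (cutoff ρ) y‖ :=
          norm_add_le _ _
      _ ≤ 1 * (C / R) + 1 * (C / ρ) := by
          rw [norm_smul, norm_smul, norm_neg, Real.norm_eq_abs, Real.norm_eq_abs]
          exact add_le_add (mul_le_mul h1ρ (hC R hR y) (norm_nonneg _) zero_le_one)
            (mul_le_mul h1R (hC ρ hρ y) (norm_nonneg _) zero_le_one)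
      _ ≤ Cψ := by
          rw [hCψ, one_mul, one_mul]
          have : C / R ≤ C / ρ := div_le_div_of_nonneg_left hC0 hρ hρR
          have e3 : 2 * C / ρ = 2 * (C / ρ) := by ring
          linarith
  -- ### the cut-off field `w = ψ v ∈ C²_c`
  set w : EuclideanSpace ℝ (Fin 3) → EuclideanSpace ℝ (Fin 3) := fun y => ψ y • v y with hw
  have hws : ContDiff ℝ 2 w := hψs.smul hv
  have hw1 : ContDiff ℝ 1 w := hws.of_le (by norm_num)
  have hwc : HasCompactSupport w := hψc.smul_right
  have hvd : ∀ y, DifferentiableAt ℝ v y := fun y => (hv.differentiable (by simp)) y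
  have hvc0 : Continuous v := hv.continuous
  have hwc0 : Continuous w := hws.continuous
  have hDwc : Continuous (fderiv ℝ w) := hw1.continuous_fderiv (by simp)
  -- pointwise: `‖w‖ ≤ ‖v‖`, `w = v` on the shell
  have hwle : ∀ y, ‖w y‖ ≤ ‖v y‖ := fun y => by
    rw [hw]; dsimp only; rw [norm_smul, Real.norm_eq_abs]
    exact mul_le_of_le_one_left (norm_nonneg _) (hψabs y)
  have hweq : ∀ y : EuclideanSpace ℝ (Fin 3), 2 * ρ ≤ ‖y‖ → ‖y‖ ≤ R → w y = v y := fun y h1 h2 => by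
    simp only [hw, hψone y h1 h2, one_smul]
  -- ### the energy of `v` and the exterior enstrophy as Bochner integrals
  obtain ⟨hv2i, hv2⟩ := integrable_norm_sq_of_lintegral_le hvc0 hE₂ h2
  set S₀ : Set (EuclideanSpace ℝ (Fin 3)) := (ball (0 : EuclideanSpace ℝ (Fin 3)) ρ)ᶜ with hS₀
  have hS₀m : MeasurableSet S₀ := measurableSet_ball.compl
  have hcurlc : Continuous fun y => ‖curl v y‖ ^ 2 := by
    rw [show (fun y => ‖curl v y‖ ^ 2) = fun y => ‖curlCLM (fderiv ℝ v y)‖ ^ 2 from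
      funext fun y => by rw [curl_eq_curlCLM]]
    exact (curlCLM.continuous.comp (hv.continuous_fderiv (by simp))).norm.pow 2
  -- the indicator of the exterior enstrophy density
  set g : EuclideanSpace ℝ (Fin 3) → ℝ := S₀.indicator fun y => ‖curl v y‖ ^ 2 with hg
  have hg0 : ∀ y, 0 ≤ g y := fun y => by
    rw [hg]; exact Set.indicator_nonneg (fun z _ => by positivity) y
  have hgm : AEStronglyMeasurable g volume :=
    (hcurlc.aestronglyMeasurable).indicator hS₀m
  obtain ⟨hgi, hgle⟩ : Integrable g ∧ ∫ y, g y ≤ B := by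
    refine integrable_and_integral_le_of_lintegral_le hgm hg0 hB ?_
    have e : ∫⁻ y, ENNReal.ofReal (g y) = ∫⁻ y in S₀, ‖curl v y‖ₑ ^ 2 := by
      rw [← lintegral_indicator hS₀m]
      refine lintegral_congr fun y => ?_
      rw [hg]
      by_cases hy : y ∈ S₀
      · rw [indicator_of_mem hy, indicator_of_mem hy, ← ofReal_norm, ENNReal.ofReal_pow (norm_nonneg _)]
      · rw [indicator_of_notMem hy, indicator_of_notMem hy, ENNReal.ofReal_zero]
    rw [e]; exact hcurl
  -- ### pointwise Leibniz bounds
  have hcurlw : ∀ y, ‖curl w y‖ ^ 2 ≤ 2 * g y + 32 * Cψ ^ 2 * ‖v y‖ ^ 2 := by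
    intro y
    have h1 := norm_curl_smul_le (hψd y) (hvd y)
    have hψg : |ψ y| ^ 2 * ‖curl v y‖ ^ 2 ≤ g y := by
      by_cases hy : y ∈ S₀
      · rw [hg, indicator_of_mem hy]
        exact mul_le_of_le_one_left (by positivity) (by
          have := hψabs y; nlinarith [abs_nonneg (ψ y)])
      · have hy' : ‖y‖ ≤ ρ := by
          rw [hS₀, mem_compl_iff, not_not, mem_ball, dist_zero_right] at hy; exact hy.le
        rw [hψin y hy', abs_zero]; simp [hg0 y]
    have hD := hDψ y
    have ha : 0 ≤ |ψ y| * ‖curl v y‖ := by positivity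
    have hb : 0 ≤ 4 * ‖fderiv ℝ ψ y‖ * ‖v y‖ := by positivity
    calc ‖curl w y‖ ^ 2 ≤ (|ψ y| * ‖curl v y‖ + 4 * ‖fderiv ℝ ψ y‖ * ‖v y‖) ^ 2 :=
          pow_le_pow_left₀ (norm_nonneg _) h1 2
      _ ≤ 2 * (|ψ y| * ‖curl v y‖) ^ 2 + 2 * (4 * ‖fderiv ℝ ψ y‖ * ‖v y‖) ^ 2 := by
          nlinarith [sq_nonneg (|ψ y| * ‖curl v y‖ - 4 * ‖fderiv ℝ ψ y‖ * ‖v y‖)]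
      _ ≤ 2 * g y + 32 * Cψ ^ 2 * ‖v y‖ ^ 2 := by
          have h3 : (4 * ‖fderiv ℝ ψ y‖ * ‖v y‖) ^ 2 ≤ 16 * Cψ ^ 2 * ‖v y‖ ^ 2 := by
            have := mul_le_mul hD hD (norm_nonneg _) hCψ0
            nlinarith [norm_nonneg (v y), sq_nonneg ‖v y‖, norm_nonneg (fderiv ℝ ψ y)]
          nlinarith [hψg, mul_pow (|ψ y|) (‖curl v y‖) 2]
  have hdivw : ∀ y, VectorCalculus.divergence w y ^ 2 ≤ Cψ ^ 2 * ‖v y‖ ^ 2 := by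
    intro y
    have h1 := abs_divergence_smul_le (hψd y) (hvd y) (hdiv y)
    have h2 : |VectorCalculus.divergence w y| ≤ Cψ * ‖v y‖ :=
      h1.trans (mul_le_mul_of_nonneg_right (hDψ y) (norm_nonneg _))
    calc VectorCalculus.divergence w y ^ 2 = |VectorCalculus.divergence w y| ^ 2 := (sq_abs _).symm
      _ ≤ (Cψ * ‖v y‖) ^ 2 := pow_le_pow_left₀ (abs_nonneg _) h2 2
      _ = Cψ ^ 2 * ‖v y‖ ^ 2 := by ring
  -- ### the gradient budget `∫ ‖Dw‖² ≤ 2B + 33 Cψ² E₂`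
  have hDcs : HasCompactSupport (fun y => ‖fderiv ℝ w y‖ ^ 2) := by
    have h := (hwc.fderiv (𝕜 := ℝ)).norm.comp_left (g := fun t : ℝ => t ^ 2) (by simp)
    simpa only [Function.comp_def] using h
  have hDwi : Integrable (fun y => ‖fderiv ℝ w y‖ ^ 2) :=
    (hDwc.norm.pow 2).integrable_of_hasCompactSupport hDcs
  have hfrobL : Continuous fun L : EuclideanSpace ℝ (Fin 3) →L[ℝ] EuclideanSpace ℝ (Fin 3) =>
      frobeniusNormSq L := by
    unfold frobeniusNormSq
    refine continuous_finsetSum _ fun i _ => ?_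
    exact (continuous_eval_const (stdOrthonormalBasis ℝ (EuclideanSpace ℝ (Fin 3)) i)).norm.pow 2
  have hfrobc : Continuous fun y => frobeniusNormSq (fderiv ℝ w y) := hfrobL.comp hDwc
  have hfrob0 : frobeniusNormSq (0 : EuclideanSpace ℝ (Fin 3) →L[ℝ] EuclideanSpace ℝ (Fin 3)) = 0 := by
    unfold frobeniusNormSq
    exact Finset.sum_eq_zero fun i _ => by rw [_root_.zero_apply, norm_zero]; ring
  have hfrobi : Integrable (fun y => frobeniusNormSq (fderiv ℝ w y)) := by
    refine hfrobc.integrable_of_hasCompactSupport ?_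
    refine HasCompactSupport.intro (hwc.fderiv (𝕜 := ℝ)).isCompact fun y hy => ?_
    rw [image_eq_zero_of_notMem_tsupport hy, hfrob0]
  have hcurlwc : Continuous fun y => ‖curl w y‖ ^ 2 := by
    rw [show (fun y => ‖curl w y‖ ^ 2) = fun y => ‖curlCLM (fderiv ℝ w y)‖ ^ 2 from
      funext fun y => by rw [curl_eq_curlCLM]]
    exact (curlCLM.continuous.comp hDwc).norm.pow 2
  have hcurlwi : Integrable (fun y => ‖curl w y‖ ^ 2) := by
    refine hcurlwc.integrable_of_hasCompactSupport ?_
    refine HasCompactSupport.intro (hwc.fderiv (𝕜 := ℝ)).isCompact fun y hy => ?_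
    rw [curl_eq_curlCLM, image_eq_zero_of_notMem_tsupport hy, map_zero, norm_zero]; ring
  have hdivwc : Continuous fun y => VectorCalculus.divergence w y ^ 2 :=
    (continuous_divergence hDwc).pow 2
  have hdivwi : Integrable (fun y => VectorCalculus.divergence w y ^ 2) := by
    refine hdivwc.integrable_of_hasCompactSupport ?_
    refine HasCompactSupport.intro hwc.isCompact fun y hy => ?_
    rw [divergence_eq_zero_of_notMem_tsupport hy]; ring
  have hbudget : ∫ y, ‖fderiv ℝ w y‖ ^ 2 ≤ 2 * B + 33 * Cψ ^ 2 * E₂ := by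
    calc ∫ y, ‖fderiv ℝ w y‖ ^ 2 ≤ ∫ y, frobeniusNormSq (fderiv ℝ w y) :=
          integral_mono hDwi hfrobi fun y => norm_sq_le_frobeniusNormSq _
      _ = (∫ y, ‖curl w y‖ ^ 2) + ∫ y, VectorCalculus.divergence w y ^ 2 :=
          integral_frobeniusNormSq_fderiv_eq_of_hasCompactSupport hws hwc
      _ ≤ (∫ y, (2 * g y + 32 * Cψ ^ 2 * ‖v y‖ ^ 2)) + ∫ y, Cψ ^ 2 * ‖v y‖ ^ 2 :=
          add_le_add (integral_mono hcurlwi ((hgi.const_mul 2).add (hv2i.const_mul _)) hcurlw)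
            (integral_mono hdivwi (hv2i.const_mul _) hdivw)
      _ = 2 * (∫ y, g y) + 32 * Cψ ^ 2 * (∫ y, ‖v y‖ ^ 2) + Cψ ^ 2 * ∫ y, ‖v y‖ ^ 2 := by
          rw [integral_add (hgi.const_mul 2) (hv2i.const_mul _), integral_const_mul, integral_const_mul,
            integral_const_mul]
      _ ≤ 2 * B + 32 * Cψ ^ 2 * E₂ + Cψ ^ 2 * E₂ := by
          have := mul_le_mul_of_nonneg_left hv2 (sq_nonneg Cψ)
          nlinarith [hgle, hv2, sq_nonneg Cψ]
      _ = 2 * B + 33 * Cψ ^ 2 * E₂ := by ring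
  -- ### the `L³` Gagliardo–Nirenberg inequality for `w`
  have hcs : ∀ n : ℕ, n ≠ 0 → HasCompactSupport (fun y => ‖w y‖ ^ n) := fun n hn => by
    have h := hwc.norm.comp_left (g := fun t : ℝ => t ^ n) (zero_pow hn)
    simpa only [Function.comp_def] using h
  have hw2i : Integrable (fun y => ‖w y‖ ^ 2) := (hwc0.norm.pow 2).integrable_of_hasCompactSupport
    (hcs 2 (by norm_num))
  have hw4i : Integrable (fun y => ‖w y‖ ^ 4) := (hwc0.norm.pow 4).integrable_of_hasCompactSupport
    (hcs 4 (by norm_num))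
  have hw6i : Integrable (fun y => ‖w y‖ ^ 6) := (hwc0.norm.pow 6).integrable_of_hasCompactSupport
    (hcs 6 (by norm_num))
  have hw3i : Integrable (fun y => ‖w y‖ ^ 3) := (hwc0.norm.pow 3).integrable_of_hasCompactSupport
    (hcs 3 (by norm_num))
  have hGNS := integral_norm_pow_three_le_of_integrable (volume : Measure (EuclideanSpace ℝ (Fin 3)))
    finrank_euclideanSpace_fin hw1 hw2i hw4i hw6i hDwi
  have hA : ∫ y, ‖w y‖ ^ 2 ≤ E₂ :=
    (integral_mono hw2i hv2i fun y => pow_le_pow_left₀ (norm_nonneg _) (hwle y) 2).trans hv2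
  have hA0 : 0 ≤ ∫ y, ‖w y‖ ^ 2 := integral_nonneg fun y => by positivity
  have hD0 : 0 ≤ ∫ y, ‖fderiv ℝ w y‖ ^ 2 := integral_nonneg fun y => by positivity
  have hK0 : 0 ≤ K := NNReal.coe_nonneg _
  set M : ℝ := K ^ (3 / 2 : ℝ) * E₂ ^ (3 / 4 : ℝ) * (2 * B + 33 * Cψ ^ 2 * E₂) ^ (3 / 4 : ℝ) with hM
  have hL3 : ∫ y, ‖w y‖ ^ 3 ≤ M := by
    refine hGNS.trans ?_
    rw [hM]
    have h34 : (0 : ℝ) ≤ 3 / 4 := by norm_num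
    gcongr
  -- ### the shell integral is dominated by `∫ ‖w‖³`
  set S : Set (EuclideanSpace ℝ (Fin 3)) := {x | 2 * ρ ≤ ‖x‖ ∧ ‖x‖ ≤ R} with hS
  have hSm : MeasurableSet S :=
    (isClosed_le continuous_const continuous_norm).measurableSet.inter
      (isClosed_le continuous_norm continuous_const).measurableSet
  have h3w : ∫⁻ x in S, ‖v x‖ₑ ^ 3 ≤ ∫⁻ x, ‖w x‖ₑ ^ 3 := by
    rw [← lintegral_indicator hSm]
    refine lintegral_mono fun y => ?_
    by_cases hy : y ∈ S
    · rw [indicator_of_mem hy, hweq y hy.1 hy.2]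
    · rw [indicator_of_notMem hy]; exact zero_le
  have hw3eq : ∫⁻ x, ‖w x‖ₑ ^ 3 = ENNReal.ofReal (∫ x, ‖w x‖ ^ 3) := by
    rw [ofReal_integral_eq_lintegral_ofReal hw3i (Eventually.of_forall fun y => by positivity)]
    refine lintegral_congr fun y => ?_
    rw [← ofReal_norm, ENNReal.ofReal_pow (norm_nonneg _)]
  calc ∫⁻ x in S, ‖v x‖ₑ ^ 3 ≤ ∫⁻ x, ‖w x‖ₑ ^ 3 := h3w
    _ = ENNReal.ofReal (∫ x, ‖w x‖ ^ 3) := hw3eq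
    _ ≤ ENNReal.ofReal M := ENNReal.ofReal_le_ofReal hL3

/-- **Exterior `L³` from energy and exterior enstrophy (exterior form).** Same hypotheses as
`lintegral_shell_norm_cube_le`; the outer radius is sent to infinity by monotone convergence
(`setLIntegral_iUnion_of_directed`): `∫⁻_{|x| ≥ 2ρ} ‖v‖ₑ³ ≤ K^{3/2} E₂^{3/4} (2B + 33 (2C/ρ)² E₂)^{3/4}`.
[folklore] -/
theorem lintegral_exterior_norm_cube_le {C : ℝ} (hC0 : 0 ≤ C)
    (hC : ∀ R : ℝ, 0 < R → ∀ x : EuclideanSpace ℝ (Fin 3), ‖fderiv ℝ (cutoff R) x‖ ≤ C / R)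
    {v : EuclideanSpace ℝ (Fin 3) → EuclideanSpace ℝ (Fin 3)} (hv : ContDiff ℝ 2 v)
    (hdiv : VectorCalculus.IsDivFree v) {E₂ B ρ : ℝ} (hE₂ : 0 ≤ E₂) (hB : 0 ≤ B) (hρ : 0 < ρ)
    (h2 : ∫⁻ x, ‖v x‖ₑ ^ 2 ≤ ENNReal.ofReal E₂)
    (hcurl : ∫⁻ x in (ball (0 : EuclideanSpace ℝ (Fin 3)) ρ)ᶜ, ‖curl v x‖ₑ ^ 2 ≤ ENNReal.ofReal B) :
    ∫⁻ x in (ball (0 : EuclideanSpace ℝ (Fin 3)) (2 * ρ))ᶜ, ‖v x‖ₑ ^ 3 ≤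
      ENNReal.ofReal ((SNormLESNormFDerivOfEqConst (EuclideanSpace ℝ (Fin 3))
          (volume : Measure (EuclideanSpace ℝ (Fin 3))) 2 : ℝ) ^ (3 / 2 : ℝ) * E₂ ^ (3 / 4 : ℝ) *
        (2 * B + 33 * (2 * C / ρ) ^ 2 * E₂) ^ (3 / 4 : ℝ)) := by
  set S : ℕ → Set (EuclideanSpace ℝ (Fin 3)) := fun n => {x | 2 * ρ ≤ ‖x‖ ∧ ‖x‖ ≤ ρ + n} with hS
  have hmono : Monotone S := by
    intro m n hmn x hx
    exact ⟨hx.1, hx.2.trans (by simpa using hmn)⟩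
  have hdir : Directed (· ⊆ ·) S := hmono.directed_le
  have hU : (ball (0 : EuclideanSpace ℝ (Fin 3)) (2 * ρ))ᶜ = ⋃ n, S n := by
    ext x
    simp only [mem_compl_iff, mem_ball, dist_zero_right, not_lt, mem_iUnion, hS, mem_setOf_eq]
    constructor
    · intro hx
      obtain ⟨n, hn⟩ := exists_nat_ge (‖x‖ - ρ)
      exact ⟨n, hx, by linarith⟩
    · rintro ⟨n, hn⟩
      exact hn.1
  rw [hU, setLIntegral_iUnion_of_directed _ hdir]
  refine iSup_le fun n => ?_
  exact lintegral_shell_norm_cube_le hC0 hC hv hdiv hE₂ hB hρ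
    (le_add_of_nonneg_right n.cast_nonneg) h2 hcurl

end Summit.NavierStokesRegularity.NavierStokesRegularity.Theorems.EnstrophyQuarterLaw.SparsenessFarField

end
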